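import Literature.NumberTheory.LFunctions.DirichletXiPairHadamard
import Mathlib.Analysis.Calculus.LogDerivUniformlyOn
import Mathlib.Analysis.Normed.Module.MultipliableUniformlyOn
import Mathlib.Analysis.SpecialFunctions.Log.Summable
import HarnessLib

/-!
# The Hadamard product of the pair `Ξ_χ = ξ(·,χ)ξ(·,χ̄)`: zeros of the factors and the partial-fraction series of `Ξ_χ'/Ξ_χ`

Topic `Literature/NumberTheory/LFunctions`, sub-namespace `DirichletTheta` (continuation of `DirichletXiPairHadamard.lean`).
Everything here is PROVED; the one definition (`xiPairZero`) is glue.  **RH-FREE and GRH-FREE.**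

`DirichletXiPairHadamard.exists_xiPair_hadamardSeq` gives, for a primitive `χ ≠ 1`, a summable `b` with
`Ξ_χ(½ + z)/Ξ_χ(2) = ∏ₙ (1 − bₙ(z² − 9/4))`.  Here (the `Ξ_χ`-twin of `RiemannXiHadamardProduct.lean` /
`DeBruijnHLogDerivSeries.lean` §Products, whose template `1 + bₙz²` is replaced by `1 − bₙ(z² − c)`; the recentring
`1 − bₙ(z² − 9/4) = (1 + 9bₙ/4)(1 − bₙ′z²)` is NOT available in general because `1 + 9bₙ/4 = 0` exactly when `ρₙ = ½`,
i.e. when `L(½, χ)L(½, χ̄) = 0`, which is not excluded):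

* template lemmas for `∏ₙ (1 − bₙ(z² − c))` with `Σ‖bₙ‖ < ∞`: locally uniform convergence on balls, non-vanishing when no
  factor vanishes, `logDeriv` of the product `= Σₙ −2bₙz/(1 − bₙ(z² − c))` (Mathlib's `logDeriv_tprod_eq_tsum`);
* `xiPairZero b n = ρₙ := ½ + (9/4 + 1/bₙ)^{1/2}` and the factorisation
  `1 − bₙ((s−½)² − 9/4) = −bₙ (s − ρₙ)(s − (1 − ρₙ))` (`factor_eq_mul`), so for `bₙ ≠ 0` both `ρₙ` and `1 − ρₙ` are zeros
  of `Ξ_χ` (`xiPair_xiPairZero`, `xiPair_one_sub_xiPairZero`), every zero of `Ξ_χ` kills a factor, and where `Ξ_χ(s) ≠ 0`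
  no factor vanishes;
* **the partial-fraction series** (`logDeriv_xiPair_half_add_eq_tsum`): at every `z` with `Ξ_χ(½ + z) ≠ 0`,
  `(d/dz) log Ξ_χ(½ + z) = Σₙ −2bₙz/(1 − bₙ(z² − 9/4))`, each non-zero term being `1/(s − ρₙ) + 1/(s − (1−ρₙ))`,
  `s = ½ + z` (`term_eq_inv_add_inv`) — MV (10.29)-shape for the pair, from the product rather than from Thm 10.13.

What is NOT here (next file): the multiplicity dictionary `#{n : ρ ∈ {ρₙ, 1−ρₙ}} = m_χ(ρ) + m_χ̄(ρ)` and the termwise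
differentiation at `s = 1` leading to `LiDirichletSplit`.

## References
* H. L. Montgomery, R. C. Vaughan, *Multiplicative Number Theory I*, §10.2, (10.29)–(10.31). [MontgomeryVaughan2007]
* J. B. Conway, *Functions of One Complex Variable I*, Ch. XI Thm. 3.4. [Conway1978]
-/

noncomputable section

open Complex Filter Topology Set Metric
open scoped ComplexConjugate

namespace Literature.NumberTheory.LFunctions

namespace DirichletTheta

/-! ### Products `∏ (1 − bₙ(z² − c))` with `∑ ‖bₙ‖ < ∞` -/

section Products

variable {ι : Type*} {b : ι → ℂ} {c : ℂ}

/-- `‖bₙ (z² − c)‖ ≤ ‖bₙ‖ (R² + ‖c‖)` on the ball `‖z‖ < R`. [folklore] -/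
private theorem norm_mul_sq_sub_le_of_mem_ball {R : ℝ} (a c : ℂ) {z : ℂ} (hz : z ∈ ball (0 : ℂ) R) :
    ‖-(a * (z ^ 2 - c))‖ ≤ ‖a‖ * (R ^ 2 + ‖c‖) := by
  rw [norm_neg, norm_mul]
  have hz' : ‖z‖ < R := by simpa using hz
  have hR : 0 ≤ R := (norm_nonneg z).trans hz'.le
  gcongr
  calc ‖z ^ 2 - c‖ ≤ ‖z ^ 2‖ + ‖c‖ := norm_sub_le _ _
    _ = ‖z‖ ^ 2 + ‖c‖ := by rw [norm_pow]
    _ ≤ R ^ 2 + ‖c‖ := by gcongr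

/-- The factors as `1 + fₙ`. [folklore] -/
private theorem factor_fun_eq (b : ι → ℂ) (c : ℂ) :
    (fun n (z : ℂ) ↦ 1 - b n * (z ^ 2 - c)) = fun n z ↦ 1 + -(b n * (z ^ 2 - c)) := by
  funext n z; ring

/-- `∏ₙ (1 − bₙ(z² − c))` converges locally uniformly on every ball (Conway VII.5–6: products `∏(1 + fₙ)` with `Σ sup|fₙ|`
convergent). [cite: Conway1978, Ch. XI Thm. 3.4] -/
theorem multipliableLocallyUniformlyOn_factor (hb : Summable fun n ↦ ‖b n‖) (c : ℂ) (R : ℝ) :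
    MultipliableLocallyUniformlyOn (fun n (z : ℂ) ↦ 1 - b n * (z ^ 2 - c)) (ball (0 : ℂ) R) := by
  rw [factor_fun_eq]
  exact Summable.multipliableLocallyUniformlyOn_one_add isOpen_ball (hb.mul_right (R ^ 2 + ‖c‖))
    (Eventually.of_forall fun n z hz ↦ norm_mul_sq_sub_le_of_mem_ball (b n) c hz) fun n ↦ by fun_prop

/-- A product `∏ₙ (1 − bₙ(z² − c))` none of whose factors vanishes is non-zero (`Σ log` converges).
[cite: Conway1978, Ch. XI Thm. 3.4] -/
theorem tprod_factor_ne_zero (hb : Summable fun n ↦ ‖b n‖) {z : ℂ} (hz : ∀ n, 1 - b n * (z ^ 2 - c) ≠ 0) :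
    ∏' n, (1 - b n * (z ^ 2 - c)) ≠ 0 := by
  have hs : Summable fun n ↦ -(b n * (z ^ 2 - c)) := ((Summable.of_norm hb).mul_right _).neg
  have hz' : ∀ n, 1 + -(b n * (z ^ 2 - c)) ≠ 0 := fun n ↦ by rw [← sub_eq_add_neg]; exact hz n
  have e : (fun n ↦ 1 - b n * (z ^ 2 - c)) = fun n ↦ 1 + -(b n * (z ^ 2 - c)) := by funext n; ring
  rw [e, ← Complex.cexp_tsum_eq_tprod hz' (Complex.summable_log_one_add_of_summable hs)]
  exact Complex.exp_ne_zero _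

/-- `logDeriv (1 − a(z² − c)) = −2az/(1 − a(z² − c))` (both sides `0` where the factor vanishes). [folklore] -/
private theorem logDeriv_factor (a c z : ℂ) :
    logDeriv (fun z ↦ 1 - a * (z ^ 2 - c)) z = -(2 * a * z) / (1 - a * (z ^ 2 - c)) := by
  rw [logDeriv_apply]
  have h : HasDerivAt (fun z ↦ 1 - a * (z ^ 2 - c)) (-(a * (2 * z))) z := by
    have h1 : HasDerivAt (fun z : ℂ ↦ z ^ 2 - c) (2 * z) z := by
      simpa using (hasDerivAt_pow 2 z).sub_const c
    simpa using (h1.const_mul a).const_sub 1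
  rw [h.deriv]
  ring

/-- The partial-fraction terms `−2bₙz/(1 − bₙ(z² − c))` are absolutely summable. [cite: Conway1978, Ch. XI Thm. 3.4] -/
theorem summable_logDeriv_factor (hb : Summable fun n ↦ ‖b n‖) (c z : ℂ) :
    Summable fun n ↦ -(2 * b n * z) / (1 - b n * (z ^ 2 - c)) := by
  have hs : Summable fun n ↦ b n * (z ^ 2 - c) := (Summable.of_norm hb).mul_right _
  refine Summable.of_norm_bounded_eventually (g := fun n ↦ 4 * ‖z‖ * ‖b n‖) (hb.mul_left (4 * ‖z‖)) ?_
  filter_upwards [hs.tendsto_cofinite_zero.eventually (Metric.ball_mem_nhds _ one_half_pos)] with n hn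
  have hn' : ‖b n * (z ^ 2 - c)‖ < 1 / 2 := by simpa using hn
  have hden : 1 / 2 ≤ ‖1 - b n * (z ^ 2 - c)‖ := by
    have := norm_sub_norm_le (1 : ℂ) (b n * (z ^ 2 - c))
    rw [norm_one] at this
    linarith
  rw [norm_div, norm_neg, norm_mul, norm_mul, Complex.norm_two, div_le_iff₀ (by linarith)]
  nlinarith [norm_nonneg (b n), norm_nonneg z, mul_nonneg (norm_nonneg (b n)) (norm_nonneg z)]

/-- **Logarithmic derivative of the product**: wherever no factor vanishes,
`(∏ₙ (1 − bₙ(z² − c)))'/∏ₙ(…) = Σₙ −2bₙz/(1 − bₙ(z² − c))`. [cite: Conway1978, Ch. XI Thm. 3.4] -/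
theorem logDeriv_tprod_factor (hb : Summable fun n ↦ ‖b n‖) {z : ℂ} (hz : ∀ n, 1 - b n * (z ^ 2 - c) ≠ 0) :
    logDeriv (fun w ↦ ∏' n, (1 - b n * (w ^ 2 - c))) z = ∑' n, -(2 * b n * z) / (1 - b n * (z ^ 2 - c)) := by
  have hR : z ∈ ball (0 : ℂ) (‖z‖ + 1) := by simp
  have h := logDeriv_tprod_eq_tsum (f := fun n w ↦ 1 - b n * (w ^ 2 - c)) isOpen_ball hR hz
    (fun n ↦ by fun_prop) ?_ (multipliableLocallyUniformlyOn_factor hb c _) (tprod_factor_ne_zero hb hz)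
  · rw [h]
    exact tsum_congr fun n ↦ logDeriv_factor (b n) c z
  · simp only [logDeriv_factor]
    exact summable_logDeriv_factor hb c z

/-- A product with a vanishing factor is `0`. [folklore] -/
private theorem eq_zero_of_hasProd_of_eq_zero {f : ℕ → ℂ} {a : ℂ} (h : HasProd f a) {n : ℕ} (hn : f n = 0) :
    a = 0 := by
  have hev : ∀ᶠ s : Finset ℕ in atTop, ∏ i ∈ s, f i = 0 := by
    filter_upwards [eventually_ge_atTop ({n} : Finset ℕ)] with s hs
    exact Finset.prod_eq_zero (hs (Finset.mem_singleton_self n)) hn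
  exact tendsto_nhds_unique h (tendsto_const_nhds.congr' (hev.mono fun s hs ↦ hs.symm))

end Products

/-! ### The zeros `ρₙ = ½ + (9/4 + 1/bₙ)^{1/2}` attached to a Hadamard sequence of `Ξ_χ` -/

section PairSeq

variable {q : ℕ} [NeZero q] {χ : DirichletCharacter ℂ q} {b : ℕ → ℂ}

/-- The zero attached to the index `n` of a Hadamard sequence of `Ξ_χ`: `ρₙ := ½ + (9/4 + 1/bₙ)^{1/2}` (principal
root), so that `(ρₙ − ½)² = 9/4 + 1/bₙ`; its partner is `1 − ρₙ`. [folklore] -/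
def xiPairZero (b : ℕ → ℂ) (n : ℕ) : ℂ :=
  1 / 2 + (9 / 4 + (b n)⁻¹) ^ ((2 : ℂ)⁻¹)

/-- `(ρₙ − ½)² = 9/4 + 1/bₙ`. [folklore] -/
private theorem xiPairZero_sub_half_sq (b : ℕ → ℂ) (n : ℕ) :
    (xiPairZero b n - 1 / 2) ^ 2 = 9 / 4 + (b n)⁻¹ := by
  rw [xiPairZero, add_sub_cancel_left, Literature.Analysis.Complex.KiKim.cpow_half_sq]

/-- **Factorisation of one Hadamard factor**: for `bₙ ≠ 0` and every `s`,
`1 − bₙ((s − ½)² − 9/4) = −bₙ (s − ρₙ)(s − (1 − ρₙ))` (the pair `ρ ↔ 1 − ρ` of the functional equation).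
[cite: MontgomeryVaughan2007, §10.2 (10.29)] -/
theorem factor_eq_mul (b : ℕ → ℂ) {n : ℕ} (hb : b n ≠ 0) (s : ℂ) :
    1 - b n * ((s - 1 / 2) ^ 2 - 9 / 4) = -(b n) * (s - xiPairZero b n) * (s - (1 - xiPairZero b n)) := by
  have hsq := xiPairZero_sub_half_sq b n
  have e : -(b n) * (s - xiPairZero b n) * (s - (1 - xiPairZero b n)) =
      -(b n) * ((s - 1 / 2) ^ 2 - (xiPairZero b n - 1 / 2) ^ 2) := by ring
  rw [e, hsq]
  field_simp
  ring

/-- **`Ξ_χ` as its Hadamard product**: `Ξ_χ(s) = Ξ_χ(2) · ∏ₙ (1 − bₙ((s−½)² − 9/4))` for all `s`.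
[cite: Conway1978, Ch. XI Thm. 3.4] -/
theorem xiPair_eq_mul_tprod (h2 : xiPair χ 2 ≠ 0)
    (hprod : ∀ z : ℂ, HasProd (fun n ↦ 1 - b n * (z ^ 2 - 9 / 4)) (xiPair χ (1 / 2 + z) / xiPair χ 2)) (s : ℂ) :
    xiPair χ s = xiPair χ 2 * ∏' n, (1 - b n * ((s - 1 / 2) ^ 2 - 9 / 4)) := by
  rw [(hprod (s - 1 / 2)).tprod_eq, add_sub_cancel, mul_div_cancel₀ _ h2]

/-- A vanishing factor forces `Ξ_χ(s) = 0`. [folklore] -/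
private theorem xiPair_eq_zero_of_factor (h2 : xiPair χ 2 ≠ 0)
    (hprod : ∀ z : ℂ, HasProd (fun n ↦ 1 - b n * (z ^ 2 - 9 / 4)) (xiPair χ (1 / 2 + z) / xiPair χ 2))
    {s : ℂ} {n : ℕ} (hn : 1 - b n * ((s - 1 / 2) ^ 2 - 9 / 4) = 0) : xiPair χ s = 0 := by
  have h := eq_zero_of_hasProd_of_eq_zero (hprod (s - 1 / 2)) hn
  rw [add_sub_cancel, div_eq_zero_iff] at h
  exact h.resolve_right h2

/-- **`ρₙ` is a zero of `Ξ_χ`** for every index with `bₙ ≠ 0`. [cite: Conway1978, Ch. XI Thm. 3.4] -/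
theorem xiPair_xiPairZero (h2 : xiPair χ 2 ≠ 0)
    (hprod : ∀ z : ℂ, HasProd (fun n ↦ 1 - b n * (z ^ 2 - 9 / 4)) (xiPair χ (1 / 2 + z) / xiPair χ 2))
    {n : ℕ} (hb : b n ≠ 0) : xiPair χ (xiPairZero b n) = 0 :=
  xiPair_eq_zero_of_factor h2 hprod (n := n) (by rw [factor_eq_mul b hb]; ring)

/-- **`1 − ρₙ` is a zero of `Ξ_χ`** for every index with `bₙ ≠ 0`. [cite: Conway1978, Ch. XI Thm. 3.4] -/
theorem xiPair_one_sub_xiPairZero (h2 : xiPair χ 2 ≠ 0)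
    (hprod : ∀ z : ℂ, HasProd (fun n ↦ 1 - b n * (z ^ 2 - 9 / 4)) (xiPair χ (1 / 2 + z) / xiPair χ 2))
    {n : ℕ} (hb : b n ≠ 0) : xiPair χ (1 - xiPairZero b n) = 0 :=
  xiPair_eq_zero_of_factor h2 hprod (n := n) (by rw [factor_eq_mul b hb]; ring)

/-- Where `Ξ_χ(s) ≠ 0`, no Hadamard factor vanishes at `s`. [cite: Conway1978, Ch. XI Thm. 3.4] -/
theorem factor_ne_zero_of_xiPair_ne_zero (h2 : xiPair χ 2 ≠ 0)
    (hprod : ∀ z : ℂ, HasProd (fun n ↦ 1 - b n * (z ^ 2 - 9 / 4)) (xiPair χ (1 / 2 + z) / xiPair χ 2))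
    {s : ℂ} (hs : xiPair χ s ≠ 0) (n : ℕ) : 1 - b n * ((s - 1 / 2) ^ 2 - 9 / 4) ≠ 0 :=
  fun hn ↦ hs (xiPair_eq_zero_of_factor h2 hprod hn)

/-- Conversely, **every zero of `Ξ_χ` kills a factor**: if `Ξ_χ(s) = 0` then `1 − bₙ((s−½)² − 9/4) = 0` for some `n`
(a convergent product of non-zero factors with `Σ‖bₙ‖ < ∞` is non-zero). [cite: Conway1978, Ch. XI Thm. 3.4] -/
theorem exists_factor_eq_zero_of_xiPair_eq_zero (hbs : Summable fun n ↦ ‖b n‖) (h2 : xiPair χ 2 ≠ 0)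
    (hprod : ∀ z : ℂ, HasProd (fun n ↦ 1 - b n * (z ^ 2 - 9 / 4)) (xiPair χ (1 / 2 + z) / xiPair χ 2))
    {s : ℂ} (hs : xiPair χ s = 0) : ∃ n, 1 - b n * ((s - 1 / 2) ^ 2 - 9 / 4) = 0 := by
  by_contra hne
  push Not at hne
  have h := tprod_factor_ne_zero (c := (9 / 4 : ℂ)) hbs hne
  rw [xiPair_eq_mul_tprod h2 hprod s] at hs
  exact (mul_ne_zero h2 h) hs

/-- One non-vanishing partial-fraction term: for `bₙ ≠ 0` and `s` off the pair `{ρₙ, 1 − ρₙ}`,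
`−2bₙ(s−½)/(1 − bₙ((s−½)² − 9/4)) = 1/(s − ρₙ) + 1/(s − (1 − ρₙ))`. [cite: MontgomeryVaughan2007, §10.2 (10.29)] -/
theorem term_eq_inv_add_inv (b : ℕ → ℂ) {n : ℕ} (hb : b n ≠ 0) {s : ℂ}
    (hs : 1 - b n * ((s - 1 / 2) ^ 2 - 9 / 4) ≠ 0) :
    -(2 * b n * (s - 1 / 2)) / (1 - b n * ((s - 1 / 2) ^ 2 - 9 / 4)) =
      (s - xiPairZero b n)⁻¹ + (s - (1 - xiPairZero b n))⁻¹ := by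
  rw [factor_eq_mul b hb] at hs ⊢
  have h1 : s - xiPairZero b n ≠ 0 := fun h ↦ hs (by rw [h]; ring)
  have h1' : s - (1 - xiPairZero b n) ≠ 0 := fun h ↦ hs (by rw [h]; ring)
  field_simp
  ring

/-- **The partial-fraction series of `Ξ_χ'/Ξ_χ`** (centred variable): at every `z` with `Ξ_χ(½ + z) ≠ 0`,
`(d/dz) log Ξ_χ(½ + z) = Σₙ −2bₙz/(1 − bₙ(z² − 9/4))` (unconditionally convergent; the non-zero terms are
`1/(s−ρₙ) + 1/(s−(1−ρₙ))`, `s = ½ + z`, by `term_eq_inv_add_inv`). [cite: MontgomeryVaughan2007, §10.2 (10.29)] -/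
theorem logDeriv_xiPair_half_add_eq_tsum (hbs : Summable fun n ↦ ‖b n‖) (h2 : xiPair χ 2 ≠ 0)
    (hprod : ∀ z : ℂ, HasProd (fun n ↦ 1 - b n * (z ^ 2 - 9 / 4)) (xiPair χ (1 / 2 + z) / xiPair χ 2))
    {z : ℂ} (hz : xiPair χ (1 / 2 + z) ≠ 0) :
    logDeriv (fun w ↦ xiPair χ (1 / 2 + w)) z = ∑' n, -(2 * b n * z) / (1 - b n * (z ^ 2 - 9 / 4)) := by
  have hfac : ∀ n, 1 - b n * (z ^ 2 - 9 / 4) ≠ 0 := by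
    intro n
    have h := factor_ne_zero_of_xiPair_ne_zero h2 hprod hz n
    rwa [add_sub_cancel_left] at h
  rw [← logDeriv_tprod_factor hbs hfac]
  have e : (fun w ↦ ∏' n, (1 - b n * (w ^ 2 - 9 / 4))) = fun w ↦ (xiPair χ 2)⁻¹ * xiPair χ (1 / 2 + w) := by
    funext w
    rw [(hprod w).tprod_eq, div_eq_inv_mul]
  rw [e, logDeriv_const_mul _ _ (inv_ne_zero h2)]

end PairSeq

end DirichletTheta

end Literature.NumberTheory.LFunctions

end
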